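import Summits.CriticalPhenomena.CardyFormulaZ2.Theorems.CardySusyWardParafermionFamiliesToSLESixTouchLowerBoundC
import Summits.CriticalPhenomena.CardyFormulaZ2.Theorems.ParafermionPrecompact.Negative.ParafermionPrecompactFalseOfBulkNondegenerate
import Literature.Probability.LatticeModels.MeshDomainJordan

/-!
# Touch lower bound on diagonal free walls (stub `stub_touchLowerBound`, reshape r2, of the line
# `exact-potential-schwarz-christoffel`, crux stmt-CriticalPhenomena-10814), D: the wall package of a family

Helper file. For a discretisation family `Λ` of a Dobrushin domain `P` (the six `IsFamily` fields) and a flat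
DIAGONAL piece of the free arc presented as a one-sided box — `P` contains
`{|a x - b y - t₀| < wτ, c - wν < a x + b y < c}` and misses `{|a x - b y - t₀| < wτ, c < a x + b y < c + wν}`
(`a, b = ±1`), the box lying in a window `W` whose closure misses the wired arc `P.arc 0` — `wall_package`
extracts, EVENTUALLY IN THE MESH `δ`, the lattice picture consumed by the touch count: with `k = ⌈c/δ⌉ - 1` the
last level under the line,
* lattice neighbours of the core `{|δ column - t₀| ≤ 5wτ/8, c - 3wν/4 ≤ δ level, level ≤ k}` are `Ω_δ`-adjacent
  (bulk of the Jordan domain, `JordanDomain.eventually_forall_mem_meshDomain'`, + part C);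
* core sites of level `≤ k - 2` (margin `2δ`) are off both discrete arcs (no boundary sites, part C);
* core sites of level `k - 1` lie on the discrete FREE arc `zdArcB`: they are boundary sites (part C), the arcs
  cover the boundary (admissibility), and they are off `zdArcA` — the point of the line above is a frontier point
  within `2δ`, off `arcA`, while `arcA` (Hausdorff-close to `P.arc 0`, which stays at distance `≥ ρ` from the
  piece of the line: `exists_pos_dist_line`, compactness `isCompact_slab`) is far.
Registered one-line ticket `stub_touch_wallD`.
-/

noncomputable section

namespace Summit.CriticalPhenomena.CardyFormulaZ2.Theorems.ParafermionFamiliesToSLESix.TouchLowerBound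

open Set Metric Complex Filter
open scoped Topology ENNReal
open Literature.Probability.LatticeModels Literature.Probability.Percolation
open Literature.Probability.RandomPlanarGeometry
open Summit.CriticalPhenomena.CardyFormulaZ2.Theorems.ParafermionPrecompact.Negative (IsFamily)

variable {a b : ℤ} {c t₀ wτ wν : ℝ}

/-! ## Compact pieces of the box -/

/-- The level functional is continuous. [folklore] -/
theorem continuous_level (a b : ℤ) : Continuous fun z : ℂ => (a : ℝ) * z.re + b * z.im := by fun_prop

/-- The column functional is continuous. [folklore] -/
theorem continuous_column (a b : ℤ) : Continuous fun z : ℂ => (a : ℝ) * z.re - b * z.im := by fun_prop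

/-- A point is bounded by its level and column: `‖z‖ ≤ |a x - b y| + |a x + b y|`. [folklore] -/
theorem norm_le_column_add_level (ha : a = 1 ∨ a = -1) (hb : b = 1 ∨ b = -1) (z : ℂ) :
    ‖z‖ ≤ |(a : ℝ) * z.re - b * z.im| + |(a : ℝ) * z.re + b * z.im| := by
  refine (Complex.norm_le_abs_re_add_abs_im z).trans ?_
  have key : ∀ s t : ℝ, |s| + |t| ≤ |s - t| + |s + t| := fun s t => by
    cases abs_cases s <;> cases abs_cases t <;> cases abs_cases (s - t) <;> cases abs_cases (s + t) <;> linarith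
  have ea : |(a : ℝ) * z.re| = |z.re| := by
    rcases ha with rfl | rfl <;> simp
  have eb : |(b : ℝ) * z.im| = |z.im| := by
    rcases hb with rfl | rfl <;> simp
  rw [← ea, ← eb]
  exact key _ _

/-- **A slab of the box is compact**: `{|column - t₀| ≤ T, N₁ ≤ level ≤ N₂}`. [folklore] -/
theorem isCompact_slab (ha : a = 1 ∨ a = -1) (hb : b = 1 ∨ b = -1) (T N₁ N₂ : ℝ) :
    IsCompact {z : ℂ | |(a : ℝ) * z.re - b * z.im - t₀| ≤ T ∧ N₁ ≤ (a : ℝ) * z.re + b * z.im ∧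
      (a : ℝ) * z.re + b * z.im ≤ N₂} := by
  refine Metric.isCompact_of_isClosed_isBounded ?_ ?_
  · exact (isClosed_le ((continuous_column a b).sub continuous_const).abs continuous_const).inter
      ((isClosed_le continuous_const (continuous_level a b)).inter (isClosed_le (continuous_level a b) continuous_const))
  · rw [isBounded_iff_forall_norm_le]
    refine ⟨|t₀| + T + (|N₁| + |N₂|), fun z hz => ?_⟩
    obtain ⟨h1, h2, h3⟩ := hz
    refine (norm_le_column_add_level ha hb z).trans ?_
    have e1 : |(a : ℝ) * z.re - b * z.im| ≤ |t₀| + T := by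
      have := abs_sub_abs_le_abs_sub ((a : ℝ) * z.re - b * z.im) t₀
      linarith
    have e2 : |(a : ℝ) * z.re + b * z.im| ≤ |N₁| + |N₂| := by
      rw [abs_le]
      constructor <;> cases abs_cases N₁ <;> cases abs_cases N₂ <;> linarith
    linarith

/-- **A compact set whose closure-window misses it stays away from the piece of the line.** If the box lies in
`W` and `closure W` misses the compact set `S`, then the points of the line `{level = c, |column - t₀| ≤ 5wτ/8}`
(limits of box points) are at distance `≥ ρ > 0` from `S`. [folklore] -/
theorem exists_pos_dist_line (ha : a = 1 ∨ a = -1) (hb : b = 1 ∨ b = -1) (hwτ : 0 < wτ) (hwν : 0 < wν)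
    {W S : Set ℂ} (hS : IsCompact S) (hWS : Disjoint (closure W) S)
    (hRW : ∀ z : ℂ, |a * z.re - b * z.im - t₀| < wτ → |a * z.re + b * z.im - c| < wν → z ∈ W) :
    ∃ ρ > 0, ∀ z : ℂ, |a * z.re - b * z.im - t₀| ≤ 5 * wτ / 8 → (a : ℝ) * z.re + b * z.im = c →
      ∀ s ∈ S, ρ ≤ dist z s := by
  rcases S.eq_empty_or_nonempty with rfl | hSne
  · exact ⟨1, one_pos, fun z _ _ s hs => hs.elim⟩
  -- the piece of the line
  set L : Set ℂ := {z : ℂ | |(a : ℝ) * z.re - b * z.im - t₀| ≤ 5 * wτ / 8 ∧ c ≤ (a : ℝ) * z.re + b * z.im ∧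
      (a : ℝ) * z.re + b * z.im ≤ c} with hL
  have hLc : IsCompact L := isCompact_slab ha hb _ _ _
  -- it lies in `closure W`: apply `frontier_of_line` to the lower half-box
  set B : Set ℂ := {z : ℂ | |(a : ℝ) * z.re - b * z.im - t₀| < wτ ∧ c - wν < (a : ℝ) * z.re + b * z.im ∧
      (a : ℝ) * z.re + b * z.im < c} with hB
  have hBo : IsOpen B :=
    (isOpen_lt ((continuous_column a b).sub continuous_const).abs continuous_const).inter
      ((isOpen_lt continuous_const (continuous_level a b)).inter (isOpen_lt (continuous_level a b) continuous_const))
  have hBW : B ⊆ W := fun z hz => hRW z hz.1 (by rw [abs_lt]; constructor <;> linarith [hz.2.1, hz.2.2])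
  have hLW : L ⊆ closure W := by
    intro z hz
    obtain ⟨h1, h2, h3⟩ := hz
    have hτ : |(a : ℝ) * z.re - b * z.im - t₀| < wτ := lt_of_le_of_lt h1 (by linarith)
    refine closure_mono hBW (frontier_subset_closure (frontier_of_line (Ω := B) hBo ha hb hwν
      (fun w hw h1 h2 => ⟨hw, h1, h2⟩) (fun w _ h1 _ hw => ?_) hτ (le_antisymm h3 h2)))
    have := hw.2.2
    linarith
  have hdisj : Disjoint L S := Set.disjoint_of_subset_left hLW hWS
  obtain ⟨ρ, hρ, hρL⟩ := exists_pos_forall_lt_infDist hLc hS.isClosed hdisj hSne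
  refine ⟨ρ, hρ, fun z hτ hν s hs => ?_⟩
  have hz : z ∈ L := ⟨hτ, hν.ge, hν.le⟩
  exact (hρL z hz).le.trans (infDist_le_dist_of_mem hs)

/-! ## The wall package -/

/-- **The wall package of a discretisation family along a flat diagonal piece of the free arc, eventually in
the mesh.** See the module docstring. [folklore] -/
theorem wall_package (P : DobrushinDomain) (Λ : ℝ → DiscreteDobrushin) (hΛ : IsFamily P Λ) (W : Set ℂ)
    (hW : Disjoint (closure W) (P.arc 0)) (ha : a = 1 ∨ a = -1) (hb : b = 1 ∨ b = -1) (hwτ : 0 < wτ)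
    (hwν : 0 < wν)
    (hRW : ∀ z : ℂ, |a * z.re - b * z.im - t₀| < wτ → |a * z.re + b * z.im - c| < wν → z ∈ W)
    (hin : ∀ z : ℂ, |a * z.re - b * z.im - t₀| < wτ → c - wν < a * z.re + b * z.im → a * z.re + b * z.im < c →
      z ∈ P.carrier)
    (hout : ∀ z : ℂ, |a * z.re - b * z.im - t₀| < wτ → c < a * z.re + b * z.im → a * z.re + b * z.im < c + wν →
      z ∉ P.carrier) :
    ∀ᶠ δ in 𝓝[>] (0:ℝ), ∃ k : ℤ, δ * k < c ∧ c ≤ δ * (k + 1) ∧ 0 < δ ∧ 16 * δ ≤ wτ ∧ 16 * δ ≤ wν ∧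
      (Λ δ).Ω = P.carrier ∧ (Λ δ).δ = δ ∧
      (∀ u w : Site 2, (zdGraph 2).Adj u w →
        |δ * ((a * u 0 - b * u 1 : ℤ) : ℝ) - t₀| ≤ 5 * wτ / 8 → c - 3 * wν / 4 ≤ δ * ((a * u 0 + b * u 1 : ℤ) : ℝ) →
        a * u 0 + b * u 1 ≤ k →
        |δ * ((a * w 0 - b * w 1 : ℤ) : ℝ) - t₀| ≤ 5 * wτ / 8 → c - 3 * wν / 4 ≤ δ * ((a * w 0 + b * w 1 : ℤ) : ℝ) →
        a * w 0 + b * w 1 ≤ k → (discreteDomainGraph (Λ δ).Ω (Λ δ).δ).Adj u w) ∧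
      (∀ v : Site 2, |δ * ((a * v 0 - b * v 1 : ℤ) : ℝ) - t₀| ≤ 5 * wτ / 8 - 2 * δ →
        c - 3 * wν / 4 + 2 * δ ≤ δ * ((a * v 0 + b * v 1 : ℤ) : ℝ) → a * v 0 + b * v 1 ≤ k - 2 →
        v ∉ (Λ δ).zdArcA ∧ v ∉ (Λ δ).zdArcB) ∧
      (∀ y : Site 2, |δ * ((a * y 0 - b * y 1 : ℤ) : ℝ) - t₀| ≤ 5 * wτ / 8 - 2 * δ → a * y 0 + b * y 1 = k - 1 →
        y ∈ (Λ δ).zdArcB) := by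
  obtain ⟨hΩ, hδ', hA, -, -, hadm⟩ := hΛ
  have hPo : IsOpen P.carrier := P.isOpen
  -- the wired arc stays at distance `≥ ρ` from the piece of the line
  obtain ⟨ρ, hρ, hρfar⟩ := exists_pos_dist_line (c := c) ha hb hwτ hwν (P.isCompact_arc 0) hW hRW
  -- the bulk compact
  set K : Set ℂ := {z : ℂ | |(a : ℝ) * z.re - b * z.im - t₀| ≤ 3 * wτ / 4 ∧ c - 3 * wν / 4 ≤ (a : ℝ) * z.re + b * z.im ∧
      (a : ℝ) * z.re + b * z.im ≤ c - wν / 4} with hK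
  have hKc : IsCompact K := isCompact_slab ha hb _ _ _
  have hKP : K ⊆ P.carrier := fun z hz => hin z (lt_of_le_of_lt hz.1 (by linarith)) (by linarith [hz.2.1])
    (by linarith [hz.2.2])
  have hbulk := P.toJordanDomain.eventually_forall_mem_meshDomain' hKc hKP
  have hρ4 : (0 : ℝ≥0∞) < ENNReal.ofReal (ρ / 4) := ENNReal.ofReal_pos.2 (by positivity)
  have hδ₀ : (0:ℝ) < min (min (wτ / 16) (wν / 16)) (ρ / 16) := by positivity
  filter_upwards [hadm, hA.eventually (gt_mem_nhds hρ4), hbulk, Ioo_mem_nhdsGT hδ₀] with δ hadmδ hAδ hbulkδ hδδ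
  obtain ⟨hδ, hδlt⟩ := hδδ
  have hm1 : min (min (wτ / 16) (wν / 16)) (ρ / 16) ≤ wτ / 16 := (min_le_left _ _).trans (min_le_left _ _)
  have hm2 : min (min (wτ / 16) (wν / 16)) (ρ / 16) ≤ wν / 16 := (min_le_left _ _).trans (min_le_right _ _)
  have hm3 : min (min (wτ / 16) (wν / 16)) (ρ / 16) ≤ ρ / 16 := min_le_right _ _
  have hδτ : 16 * δ ≤ wτ := by linarith
  have hδν : 16 * δ ≤ wν := by linarith
  have hδρ : 16 * δ ≤ ρ := by linarith
  -- the last level under the line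
  set k : ℤ := ⌈c / δ⌉ - 1 with hk_def
  have hk : δ * k < c := by
    have h1 : (k : ℝ) < c / δ := by
      rw [hk_def]; push_cast
      linarith [Int.ceil_lt_add_one (c / δ)]
    calc δ * k < δ * (c / δ) := mul_lt_mul_of_pos_left h1 hδ
      _ = c := mul_div_cancel₀ c hδ.ne'
  have hk' : c ≤ δ * (k + 1) := by
    have h1 : c / δ ≤ (k : ℝ) + 1 := by
      rw [hk_def]; push_cast
      linarith [Int.le_ceil (c / δ)]
    calc c = δ * (c / δ) := (mul_div_cancel₀ c hδ.ne').symm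
      _ ≤ δ * (k + 1) := mul_le_mul_of_nonneg_left h1 hδ.le
  -- the bulk hypothesis of part C
  have hbulkB : ∀ x : Site 2, |δ * ((a * x 0 - b * x 1 : ℤ) : ℝ) - t₀| ≤ 3 * wτ / 4 →
      c - 3 * wν / 4 ≤ δ * ((a * x 0 + b * x 1 : ℤ) : ℝ) → δ * ((a * x 0 + b * x 1 : ℤ) : ℝ) ≤ c - wν / 4 →
      x ∈ meshDomain P.carrier δ := by
    intro x h1 h2 h3
    refine hbulkδ.1 x ⟨?_, ?_, ?_⟩
    · rw [column_meshPoint]; exact h1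
    · rw [level_meshPoint]; exact h2
    · rw [level_meshPoint]; exact h3
  have hEΩ : (Λ δ).Ω = P.carrier := hΩ δ
  have hEδ : (Λ δ).δ = δ := hδ' δ
  refine ⟨k, hk, hk', hδ, hδτ, hδν, hEΩ, hEδ, ?_, ?_, ?_⟩
  · -- adjacency of the core
    intro u w huw hu₁ hu₂ hu₃ hw₁ hw₂ hw₃
    rw [hEΩ, hEδ]
    exact adj_of_core hPo ha hb hδ hwτ hwν hin hout hk (by linarith) (by linarith) hbulkB huw hu₁ hu₂ hu₃ hw₁ hw₂ hw₃
  · -- deep core sites are off both arcs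
    intro v h1 h2 h3
    have hnb := not_mem_zdBoundary_of_core hEΩ hEδ hPo ha hb hδ hwτ hwν hin hout hk (by linarith) (by linarith)
      hbulkB v h1 h2 h3
    exact ⟨fun h => hnb ((Λ δ).zdArcA_subset_zdBoundary h), fun h => hnb ((Λ δ).zdArcB_subset_zdBoundary h)⟩
  · -- level `k - 1` sites are on the free arc
    intro y h1 h2
    have hyb : y ∈ (Λ δ).zdBoundary := mem_zdBoundary_of_level hEΩ hEδ hPo ha hb hδ hwτ hwν hin hout hk hk'
      (by linarith) (by linarith) hbulkB y h1 h2
    have hyA : y ∉ (Λ δ).zdArcA := by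
      apply not_mem_zdArcA_of_lt
      rw [hEΩ, hEδ]
      -- the point of the line above `δ y`
      have hτy : |(a : ℝ) * (meshPoint δ y).re - b * (meshPoint δ y).im - t₀| < wτ := by
        rw [column_meshPoint]
        exact lt_of_le_of_lt h1 (by linarith)
      have hyl : δ * ((a * y 0 + b * y 1 : ℤ) : ℝ) = δ * k - δ := by rw [h2]; push_cast; ring
      have hνy : (a : ℝ) * (meshPoint δ y).re + b * (meshPoint δ y).im ≤ c := by
        rw [level_meshPoint, hyl]; linarith
      have hνy' : c - 2 * δ ≤ (a : ℝ) * (meshPoint δ y).re + b * (meshPoint δ y).im := by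
        rw [level_meshPoint, hyl]; linarith
      obtain ⟨f, hf, hfc, hfτ, hfd⟩ := exists_frontier_above hPo ha hb hwν hin hout hτy hνy
      have hfd' : dist (meshPoint δ y) f ≤ 2 * δ := hfd.trans (by linarith)
      have hfτ' : |(a : ℝ) * f.re - b * f.im - t₀| ≤ 5 * wτ / 8 := by
        rw [hfτ, column_meshPoint]
        linarith [abs_nonneg (δ * ((a * y 0 - b * y 1 : ℤ) : ℝ) - t₀)]
      -- `arcA` is `ρ/4`-close to `P.arc 0`, which is `ρ`-far from `f`
      have hfar : ∀ a' ∈ (Λ δ).arcA, 3 * ρ / 4 < dist f a' := by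
        intro a' ha'
        obtain ⟨a'', ha'', hd⟩ := exists_edist_lt_of_hausdorffEDist_lt ha' hAδ
        rw [edist_lt_ofReal] at hd
        have := hρfar f hfτ' hfc a'' ha''
        linarith [dist_triangle f a' a'']
      have hfA : f ∉ (Λ δ).arcA := fun h => by
        have := hfar f h
        rw [dist_self] at this
        linarith
      have h0ne : (P.arc 0).Nonempty := ⟨_, P.pt_mem_arc_self 0⟩
      have hAne : (Λ δ).arcA.Nonempty :=
        nonempty_of_hausdorffEDist_ne_top h0ne (by rw [hausdorffEDist_comm]; exact ne_top_of_lt hAδ)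
      have hup : infDist (meshPoint δ y) (frontier P.carrier \ (Λ δ).arcA) ≤ 2 * δ :=
        (infDist_le_dist_of_mem (show f ∈ frontier P.carrier \ (Λ δ).arcA from ⟨hf, hfA⟩)).trans hfd'
      have hlow : 3 * ρ / 4 - 2 * δ ≤ infDist (meshPoint δ y) (Λ δ).arcA :=
        (le_infDist hAne).2 fun a' ha' => by
          have := hfar a' ha'
          linarith [dist_triangle f (meshPoint δ y) a', dist_comm f (meshPoint δ y)]
      linarith
    exact (hadmδ.zdBoundary_subset hyb).resolve_left hyA

/-- **Registered one-line ticket `stub_touch_wallD`** (helper D of `stub_touchLowerBound`): a point is bounded by its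
diagonal level and column. [folklore] -/
theorem stub_touch_wallD : ∀ (a b : ℤ), (a = 1 ∨ a = -1) → (b = 1 ∨ b = -1) → ∀ z : ℂ, ‖z‖ ≤ |(a : ℝ) * z.re - b * z.im| + |(a : ℝ) * z.re + b * z.im| :=
  fun _ _ ha hb z => norm_le_column_add_level ha hb z

end Summit.CriticalPhenomena.CardyFormulaZ2.Theorems.ParafermionFamiliesToSLESix.TouchLowerBound

end
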